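import Summits.HodgeConjecture.CorCM.WedgeBasisCoordinates
import Summits.HodgeConjecture.CorCM.CyclicSexticTwistIsogeny
import Literature.AlgebraicGeometry.HodgeTheory.WeilClassesProductsOfFactors
import HarnessLib

/-!
# COR-CM (cell `pub-hodgecm2`), A1 line — step L5, part 1: the Weil fourfold side `B ⊞ E` and the
# `𝓞_k`-equivariant maps to the elliptic curve

HONEST FRAMING (cell pub-hodgecm2 / COR-CM, seat b30 gen 11; COUNT-NEUTRAL — no binder row of
`HOME/BINDER-OWNERS.md`, no case of the Hodge conjecture, nothing about algebraic cycles is asserted beyond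
what is displayed as hypotheses).  Lemmas on the tree's real carriers for step L5 of
`HOME/pub-hodgecm2-lit-andre-3/A1-BLUEPRINT.md` (pull-back of Weil classes of `Y = B ⊞ E` to the corner product):

* pull-backs along `biprod.fst` / `biprod.snd` of eigenvectors of `f^*`, `g^*` are eigenvectors of `(f ⊕ g)^*`
  (`map_biprodMap_map_fst`, `map_biprodMap_map_snd`), and `fst^* x_i`, `snd^* y` are linearly independent for
  independent `x_i` and `y ≠ 0` (`linearIndependent_snoc_map_fst_map_snd`);
* an iterated cup product of `2n` eigenvectors of `φ^*` for the eigenvalue `± i√d` lies in the Weil plane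
  `weilClassesOf Y φ n d` (`cupPowOne_mem_weilClassesOf_of_eigen`; van Geemen 4.9);
* for an `𝓞_k`-equivariant homomorphism `ν : A₀ ⟶ E` (`ι₀(a) ≫ ν = ν ≫ ι_E(a)`, `a ∈ 𝓞_k`, `k → K`), the
  pull-back of a `τ′`-eigenvector of `E` is a `τ′`-eigenvector for the restricted action of `k` on `H¹(A₀)`
  (`map_mem_eigenline_comp_of_equivariant`), hence has no coordinate on the `σ′`-lines of `A₀` with
  `σ′|_k ≠ τ′` (`repr_map_eq_zero_of_comp_ne`);
* `H¹` of the vertex of a limit fan `P → E` (`h` copies) is the sum of the pull-backs from the factors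
  (`exists_eq_sum_map_fan`), so an ISOGENY `g : A₀ ⟶ P` followed by the projections detects every line of
  `H¹(A₀)`: some `(g ≫ π_j)^* ℓ_τ` has a non-zero coordinate on the `s`-line, `τ = s|_k`
  (`exists_repr_map_fan_ne_zero`).

THEOREMS ONLY; no `sorry`; axioms `propext`, `Classical.choice`, `Quot.sound`.

## References
* [vanGeemen1994HodgeAV] B. van Geemen, *An introduction to the Hodge conjecture for abelian varieties*, LNM 1594
  (1994), 4.8–4.9 and proof of Thm. 6.12.
* [LangeBirkenhake1992] H. Lange, Ch. Birkenhake, *Complex Abelian Varieties* (1992), §1.1 (p. 19).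
* [Shimura1998] G. Shimura, *Abelian Varieties with Complex Multiplication and Modular Functions* (1998), §6.2
  Theorem 3 (inflation to a power of a CM elliptic curve).
-/

noncomputable section

namespace Summit.HodgeConjecture.CorCM.CyclicSextic

open CategoryTheory CategoryTheory.Limits NumberField
open Literature.AlgebraicTopology.SingularHomology
open Literature.AlgebraicGeometry Literature.AlgebraicGeometry.Motives Literature.AlgebraicGeometry.HodgeTheory
open Literature.AlgebraicGeometry.ComplexMultiplication
open Literature.NumberTheory.Automorphic.PicardCM (eigenline mem_eigenline_iff mem_eigenline_of_forall_integer)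
open Summit.HodgeConjecture.HodgeConjecture.Theorems.HodgeAbelianVarieties.CMPivotAndre

/-! ## Pull-backs along the projections of a binary biproduct -/

section Biprod

variable {B E : AbelianVariety ℂ}

/-- `(f ⊕ g)^* (fst^* e) = μ • fst^* e` when `f^* e = μ • e` (`(f ⊕ g) ≫ fst = fst ≫ f`). [cite: LangeBirkenhake1992, §1.1 (p. 19)] -/
theorem map_biprodMap_map_fst (f : B ⟶ B) (g : E ⟶ E) {e : complexBetti B.X 1} {μ : ℂ}
    (he : complexBetti.map f.hom.hom.hom 1 e = μ • e) :
    complexBetti.map (biprod.map f g).hom.hom.hom 1 (complexBetti.map (biprod.fst : B ⊞ E ⟶ B).hom.hom.hom 1 e) =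
      μ • complexBetti.map (biprod.fst : B ⊞ E ⟶ B).hom.hom.hom 1 e := by
  rw [complexBetti_map_map_one_apply, biprod.map_fst, ← complexBetti_map_map_one_apply, he, map_smul]

/-- `(f ⊕ g)^* (snd^* y) = μ • snd^* y` when `g^* y = μ • y` (`(f ⊕ g) ≫ snd = snd ≫ g`). [cite: LangeBirkenhake1992, §1.1 (p. 19)] -/
theorem map_biprodMap_map_snd (f : B ⟶ B) (g : E ⟶ E) {y : complexBetti E.X 1} {μ : ℂ}
    (hy : complexBetti.map g.hom.hom.hom 1 y = μ • y) :
    complexBetti.map (biprod.map f g).hom.hom.hom 1 (complexBetti.map (biprod.snd : B ⊞ E ⟶ E).hom.hom.hom 1 y) =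
      μ • complexBetti.map (biprod.snd : B ⊞ E ⟶ E).hom.hom.hom 1 y := by
  rw [complexBetti_map_map_one_apply, biprod.map_snd, ← complexBetti_map_map_one_apply, hy, map_smul]

/-- `inl^* fst^* = id`, `inl^* snd^* = 0`, `inr^* snd^* = id` on `H¹`. [cite: LangeBirkenhake1992, §1.1 (p. 19)] -/
theorem map_inl_map_fst (e : complexBetti B.X 1) :
    complexBetti.map (biprod.inl : B ⟶ B ⊞ E).hom.hom.hom 1
      (complexBetti.map (biprod.fst : B ⊞ E ⟶ B).hom.hom.hom 1 e) = e := by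
  rw [complexBetti_map_map_one_apply, biprod.inl_fst, complexBetti_map_id_one_apply]

/-- `inl^* snd^* = 0` on `H¹`. [cite: LangeBirkenhake1992, §1.1 (p. 19)] -/
theorem map_inl_map_snd (y : complexBetti E.X 1) :
    complexBetti.map (biprod.inl : B ⟶ B ⊞ E).hom.hom.hom 1
      (complexBetti.map (biprod.snd : B ⊞ E ⟶ E).hom.hom.hom 1 y) = 0 := by
  rw [complexBetti_map_map_one_apply, biprod.inl_snd, complexBetti_map_zero_one_apply]

/-- `inr^* snd^* = id` on `H¹`. [cite: LangeBirkenhake1992, §1.1 (p. 19)] -/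
theorem map_inr_map_snd (y : complexBetti E.X 1) :
    complexBetti.map (biprod.inr : E ⟶ B ⊞ E).hom.hom.hom 1
      (complexBetti.map (biprod.snd : B ⊞ E ⟶ E).hom.hom.hom 1 y) = y := by
  rw [complexBetti_map_map_one_apply, biprod.inr_snd, complexBetti_map_id_one_apply]

/-- **Independence on `B ⊞ E`**: for linearly independent `x_i ∈ H¹(B)` and `y ≠ 0` in `H¹(E)`, the classes
`fst^* x_0, …, fst^* x_{m-1}, snd^* y` are linearly independent in `H¹(B ⊞ E)` (apply `inl^*`, `inr^*`).
[cite: LangeBirkenhake1992, §1.1 (p. 19)] -/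
theorem linearIndependent_snoc_map_fst_map_snd {m : ℕ} {x : Fin m → complexBetti B.X 1}
    (hx : LinearIndependent ℂ x) {y : complexBetti E.X 1} (hy : y ≠ 0) :
    LinearIndependent ℂ (Fin.snoc (fun i => complexBetti.map (biprod.fst : B ⊞ E ⟶ B).hom.hom.hom 1 (x i))
      (complexBetti.map (biprod.snd : B ⊞ E ⟶ E).hom.hom.hom 1 y) : Fin (m + 1) → complexBetti (B ⊞ E).X 1) := by
  -- the pull-backs as linear maps, with their one-sided inverses `inl^*`, `inr^*`
  set F := (complexBetti.map (biprod.fst : B ⊞ E ⟶ B).hom.hom.hom 1).hom with hF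
  set G := (complexBetti.map (biprod.snd : B ⊞ E ⟶ E).hom.hom.hom 1).hom with hG
  set I := (complexBetti.map (biprod.inl : B ⟶ B ⊞ E).hom.hom.hom 1).hom with hI
  set R := (complexBetti.map (biprod.inr : E ⟶ B ⊞ E).hom.hom.hom 1).hom with hR
  have hIF : ∀ e, I (F e) = e := fun e => map_inl_map_fst e
  have hIG : ∀ z, I (G z) = 0 := fun z => map_inl_map_snd z
  have hRG : ∀ z, R (G z) = z := fun z => map_inr_map_snd z
  change LinearIndependent ℂ (Fin.snoc (fun i => F (x i)) (G y))
  refine LinearIndependent.finSnoc ?_ ?_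
  · -- `fst^*` is injective (`inl^* ∘ fst^* = id`)
    refine LinearIndependent.map' hx F ?_
    rw [LinearMap.ker_eq_bot]
    intro a b hab
    have h := congrArg I hab
    rwa [hIF, hIF] at h
  · intro hmem
    obtain ⟨c, hc⟩ := (Submodule.mem_span_range_iff_exists_fun ℂ).1 hmem
    -- apply `inl^*`: the right-hand side dies, so `Σ c_i x_i = 0`, so `c = 0`
    have h1 : ∑ i, c i • x i = 0 := by
      have h := congrArg I hc
      rw [map_sum, hIG] at h
      simpa only [map_smul, hIF] using h
    have hc0 : ∀ i, c i = 0 := fun i => (Fintype.linearIndependent_iff.1 hx c h1) i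
    have hzero : G y = 0 := by
      rw [← hc]
      exact Finset.sum_eq_zero fun i _ => by rw [hc0 i, zero_smul]
    -- apply `inr^*`: `y = 0`
    have h2 := congrArg R hzero
    rw [hRG, map_zero] at h2
    exact hy h2

end Biprod

/-! ## Iterated cup products of `φ^*`-eigenvectors lie in the Weil plane -/

section CupWeil

variable {Y : AbelianVariety ℂ}

/-- **`w₀ ⌣ ⋯ ⌣ w_{2n-1} ∈ W_K ⊗ ℂ` for `φ^*`-eigenvectors of one eigenvalue `ε = ± i√d`**: the test
endomorphisms `x·𝟙 + y·φ` act on each factor by `x + yε` (`complexBetti_map_nsmul_id_add_nsmul_one_of_mem_eigenspace`),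
hence on the product by `(x + yε)^{2n}` (`map_cupPowOne`, multilinearity) — the defining character of `E₊`
(`ε = i√d`) or `E₋` (`ε = -i√d`). [cite: vanGeemen1994HodgeAV, 4.9 and proof of Thm. 6.12] -/
theorem cupPowOne_mem_weilClassesOf_of_eigen (φ : Y ⟶ Y) {n d : ℕ} {ε : ℂ}
    (hε : ε = Complex.I * (Real.sqrt d : ℂ) ∨ ε = -(Complex.I * (Real.sqrt d : ℂ)))
    (w : Fin (2 * n) → complexBetti Y.X 1) (hw : ∀ i, complexBetti.map φ.hom.hom.hom 1 (w i) = ε • w i) :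
    cupPowOne ℂ (ComplexPoints Y.X) (2 * n) w ∈ weilClassesOf Y φ n d := by
  have key : ∀ x y : ℕ, complexBetti.map (x • 𝟙 Y + y • φ).hom.hom.hom (2 * n) (cupPowOne ℂ (ComplexPoints Y.X) (2 * n) w)
      = ((x : ℂ) + (y : ℂ) * ε) ^ (2 * n) • cupPowOne ℂ (ComplexPoints Y.X) (2 * n) w := by
    intro x y
    change singularCohomology.map ℂ ℂ (AlgPoints.mapContinuous (L := ℂ) (x • 𝟙 Y + y • φ).hom.hom.hom) (2 * n)
      (cupPowOne ℂ _ (2 * n) w) = _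
    rw [map_cupPowOne]
    have e : (fun i => singularCohomology.map ℂ ℂ (AlgPoints.mapContinuous (L := ℂ) (x • 𝟙 Y + y • φ).hom.hom.hom) 1
        (w i)) = fun i => ((x : ℂ) + (y : ℂ) * ε) • w i := by
      funext i
      exact complexBetti_map_nsmul_id_add_nsmul_one_of_mem_eigenspace
        (Module.End.mem_eigenspace_iff.mpr (hw i)) x y
    rw [e, MultilinearMap.map_smul_univ, Finset.prod_const, Finset.card_univ, Fintype.card_fin]
  rcases hε with rfl | rfl
  · refine weilClassesPlus_le_weilClassesOf Y φ n d ((mem_weilClassesPlus_iff).2 fun x y => ?_)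
    change complexBetti.map (x • 𝟙 Y + y • φ).hom.hom.hom (2 * n) _ = _
    rw [key x y]
    congr 1
    ring
  · refine weilClassesMinus_le_weilClassesOf Y φ n d ((mem_weilClassesMinus_iff).2 fun x y => ?_)
    change complexBetti.map (x • 𝟙 Y + y • φ).hom.hom.hom (2 * n) _ = _
    rw [key x y]
    congr 1
    ring

end CupWeil

/-! ## `𝓞_k`-equivariant maps to a CM elliptic curve -/

section Equivariant

variable {k K : Type} [Field k] [NumberField k] [Field K] [NumberField K] (kK : k →+* K)
variable {Ψ₀ : CMType K} {A₀ : AbelianVariety ℂ} {ι₀ : 𝓞 K →+* End A₀}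
  {θ₀ : K →+* Module.End ℂ (complexBetti A₀.X 1)}
variable {Φ₀ : CMType k} {E : AbelianVariety ℂ} {ιE : 𝓞 k →+* End E} {θE : k →+* Module.End ℂ (complexBetti E.X 1)}

/-- **Pull-back along an `𝓞_k`-equivariant homomorphism `ν : A₀ ⟶ E`** (`ι₀(a) ≫ ν = ν ≫ ι_E(a)` for
`a ∈ 𝓞_k` mapped into `𝓞_K`): a `τ′`-eigenvector `ℓ` of `E` pulls back to a `τ′`-eigenvector of the restricted
action `θ₀ ∘ (k → K)` on `H¹(A₀)` (integers suffice: `mem_eigenline_of_forall_integer`).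
[cite: Shimura1998, §6.2 Theorem 3] -/
theorem map_mem_eigenline_comp_of_equivariant (h₀ : IsCMTypeRealisation Ψ₀ A₀ ι₀ θ₀)
    (hE : IsCMTypeRealisation Φ₀ E ιE θE) {ν : A₀ ⟶ E}
    (hν : ∀ a : 𝓞 k, ι₀ (RingOfIntegers.mapRingHom kK a) ≫ ν = ν ≫ ιE a)
    {τ' : k →+* ℂ} {ℓ : complexBetti E.X 1} (hℓ : ℓ ∈ eigenline θE τ') :
    complexBetti.map ν.hom.hom.hom 1 ℓ ∈ eigenline (θ₀.comp kK) τ' := by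
  refine mem_eigenline_of_forall_integer (θ₀.comp kK) τ' fun a => ?_
  have h1 : (θ₀.comp kK) (algebraMap (𝓞 k) k a) =
      (complexBetti.map (ι₀ (RingOfIntegers.mapRingHom kK a)).hom.hom.hom 1).hom := by
    rw [h₀.2.2.1]
    rfl
  rw [h1]
  change complexBetti.map _ 1 (complexBetti.map _ 1 ℓ) = _
  rw [complexBetti_map_map_one_apply, hν a, ← complexBetti_map_map_one_apply,
    AndreProductForm.map_ι_apply_of_mem_eigenline hE hℓ, map_smul]

/-- Hence such a pull-back has ZERO coordinate on every `σ′`-line of an eigenbasis `v₀` of `H¹(A₀)` with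
`σ′|_k ≠ τ′`. [cite: Shimura1998, §6.2 Theorem 3] -/
theorem repr_map_eq_zero_of_comp_ne (h₀ : IsCMTypeRealisation Ψ₀ A₀ ι₀ θ₀)
    (hE : IsCMTypeRealisation Φ₀ E ιE θE) {ν : A₀ ⟶ E}
    (hν : ∀ a : 𝓞 k, ι₀ (RingOfIntegers.mapRingHom kK a) ≫ ν = ν ≫ ιE a)
    (v₀ : Module.Basis (K →+* ℂ) ℂ (complexBetti A₀.X 1)) (hv₀ : ∀ σ, v₀ σ ∈ eigenline θ₀ σ)
    {τ' : k →+* ℂ} {ℓ : complexBetti E.X 1} (hℓ : ℓ ∈ eigenline θE τ')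
    {σ' : K →+* ℂ} (hσ' : σ'.comp kK ≠ τ') :
    v₀.repr (complexBetti.map ν.hom.hom.hom 1 ℓ) σ' = 0 := by
  obtain ⟨a, ha⟩ : ∃ a : k, σ' (kK a) ≠ τ' a := not_forall.mp fun h => hσ' (RingHom.ext h)
  have hz := (mem_eigenline_iff (θ₀.comp kK) τ').1 (map_mem_eigenline_comp_of_equivariant kK h₀ hE hν hℓ) a
  exact WedgeCoordinates.repr_eq_zero_of_apply_eq_smul ((θ₀.comp kK) a) v₀ (fun σ => σ (kK a))
    (fun σ => (mem_eigenline_iff θ₀ σ).1 (hv₀ σ) (kK a)) hz ha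

end Equivariant

/-! ## `H¹` of the vertex of a limit fan, and detection of lines through an isogeny onto it -/

section Fan

variable {E : AbelianVariety ℂ} {h : ℕ} {P : AbelianVariety ℂ} (π : Fin h → (P ⟶ E))

/-- **`H¹(P) = Σ_j π_j^* H¹(E)` for a limit fan** (transport of the biproduct decomposition
`x = Σ_j π_j^* ι_j^* x`, `Pohlmann1968.sum_map_π_map_ι`, along the comparison isomorphism `P ≅ ⨁_j E`).
[cite: LangeBirkenhake1992, §1.1 (p. 19)] -/
theorem exists_eq_sum_map_fan (hlim : IsLimit (Fan.mk P π)) (y : complexBetti P.X 1) :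
    ∃ u : Fin h → complexBetti E.X 1, y = ∑ j, complexBetti.map (π j).hom.hom.hom 1 (u j) := by
  classical
  let F : Fin h → AbelianVariety ℂ := fun _ => E
  let e : P ≅ ⨁ F := hlim.conePointUniqueUpToIso (biproduct.isLimit F)
  have he : ∀ j, e.hom ≫ biproduct.π F j = π j := fun j => by
    have := hlim.conePointUniqueUpToIso_hom_comp (biproduct.isLimit F) ⟨j⟩
    simp only [Bicone.toCone_π_app_mk, biproduct.bicone_π, Fan.mk_π_app] at this
    exact this
  set y' := complexBetti.map e.inv.hom.hom.hom 1 y with hy'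
  refine ⟨fun j => complexBetti.map (biproduct.ι F j).hom.hom.hom 1 y', ?_⟩
  have hy : y = complexBetti.map e.hom.hom.hom.hom 1 y' := by
    rw [hy', complexBetti_map_map_one_apply, Iso.hom_inv_id, complexBetti_map_id_one_apply]
  calc y = complexBetti.map e.hom.hom.hom.hom 1 y' := hy
    _ = complexBetti.map e.hom.hom.hom.hom 1 (∑ j, complexBetti.map (biproduct.π F j).hom.hom.hom 1
          (complexBetti.map (biproduct.ι F j).hom.hom.hom 1 y')) := by
        rw [Literature.AlgebraicGeometry.Pohlmann1968.sum_map_π_map_ι F y']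
    _ = ∑ j, complexBetti.map (π j).hom.hom.hom 1 (complexBetti.map (biproduct.ι F j).hom.hom.hom 1 y') := by
        rw [map_sum]
        refine Finset.sum_congr rfl fun j _ => ?_
        rw [complexBetti_map_map_one_apply, he j]

variable {k K : Type} [Field k] [NumberField k] [Field K] [NumberField K] (kK : k →+* K)
variable {Ψ₀ : CMType K} {A₀ : AbelianVariety ℂ} {ι₀ : 𝓞 K →+* End A₀}
  {θ₀ : K →+* Module.End ℂ (complexBetti A₀.X 1)}
variable {Φ₀ : CMType k} {ιE : 𝓞 k →+* End E} {θE : k →+* Module.End ℂ (complexBetti E.X 1)}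

/-- **An isogeny onto a power of `E` detects every eigenline of `A₀`**: for an isogeny `g : A₀ ⟶ P` onto the
vertex of a limit fan `π_j : P ⟶ E` with all `g ≫ π_j` `𝓞_k`-equivariant, an eigenbasis `v₀` of `A₀` and an
eigenbasis `v_E` of `E`, and an embedding `s` of `K` with restriction `τ = s|_k`: some `(g ≫ π_j)^* (v_E τ)` has a
non-zero `s`-coordinate.  (`g^*` is surjective on `H¹`, `H¹(P) = Σ π_j^* H¹(E)`, and the `τ̄`-type pull-backs have
no `s`-coordinate.) [cite: Shimura1998, §6.2 Theorem 3] -/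
theorem exists_repr_map_fan_ne_zero (h₀ : IsCMTypeRealisation Ψ₀ A₀ ι₀ θ₀)
    (hE : IsCMTypeRealisation Φ₀ E ιE θE) (hlim : IsLimit (Fan.mk P π)) {g : A₀ ⟶ P}
    (hg : AbelianVariety.IsIsogeny g)
    (hν : ∀ (j : Fin h) (a : 𝓞 k), ι₀ (RingOfIntegers.mapRingHom kK a) ≫ (g ≫ π j) = (g ≫ π j) ≫ ιE a)
    (v₀ : Module.Basis (K →+* ℂ) ℂ (complexBetti A₀.X 1)) (hv₀ : ∀ σ, v₀ σ ∈ eigenline θ₀ σ)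
    (vE : Module.Basis (k →+* ℂ) ℂ (complexBetti E.X 1)) (hvE : ∀ τ, vE τ ∈ eigenline θE τ)
    (s : K →+* ℂ) :
    ∃ j : Fin h, v₀.repr (complexBetti.map (g ≫ π j).hom.hom.hom 1 (vE (s.comp kK))) s ≠ 0 := by
  classical
  -- `v₀ s = g^* y`, `y = Σ_j π_j^* u_j`, `u_j = Σ_τ' c_{jτ'} vE τ'`
  obtain ⟨y, hy⟩ := (complexBetti_map_one_bijective_of_isIsogeny hg).2 (v₀ s)
  obtain ⟨u, hu⟩ := exists_eq_sum_map_fan π hlim y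
  have hvs : v₀ s = ∑ j, ∑ τ', vE.repr (u j) τ' •
      complexBetti.map (g ≫ π j).hom.hom.hom 1 (vE τ') := by
    rw [← hy, hu, map_sum]
    refine Finset.sum_congr rfl fun j _ => ?_
    rw [complexBetti_map_map_one_apply]
    conv_lhs => rw [← vE.sum_repr (u j)]
    rw [map_sum]
    refine Finset.sum_congr rfl fun τ' _ => ?_
    rw [map_smul]
  -- take the `s`-coordinate: `1 = Σ_j Σ_τ' c_{jτ'} · repr(…) s`, and the `τ' ≠ τ` terms vanish
  have hone : (1 : ℂ) = ∑ j, ∑ τ', vE.repr (u j) τ' *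
      v₀.repr (complexBetti.map (g ≫ π j).hom.hom.hom 1 (vE τ')) s := by
    have := congrArg (fun z => v₀.repr z s) hvs
    simpa only [Module.Basis.repr_self, Finsupp.single_eq_same, map_sum, map_smul, Finsupp.finsetSum_apply,
      Finsupp.smul_apply, smul_eq_mul] using this
  by_contra hall
  push Not at hall
  have hzero : ∀ j τ', vE.repr (u j) τ' * v₀.repr (complexBetti.map (g ≫ π j).hom.hom.hom 1 (vE τ')) s = 0 := by
    intro j τ'
    by_cases hτ : τ' = s.comp kK
    · rw [hτ, hall j, mul_zero]
    · rw [repr_map_eq_zero_of_comp_ne kK h₀ hE (hν j) v₀ hv₀ (hvE τ') (Ne.symm hτ), mul_zero]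
  have : (1 : ℂ) = 0 := by
    rw [hone]
    exact Finset.sum_eq_zero fun j _ => Finset.sum_eq_zero fun τ' _ => hzero j τ'
  exact one_ne_zero this

end Fan

end Summit.HodgeConjecture.CorCM.CyclicSextic

end
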